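import Summits.BirchSwinnertonDyer.BirchSwinnertonDyer.Theorems.KolyvaginDepthDoorDepthTableRows3
import Summits.BirchSwinnertonDyer.BirchSwinnertonDyer.Theorems.KolyvaginDepthDoorDepthTableRows4
import HarnessLib

/-!
# Route `KolyvaginDepthDoor` — DEPTH TABLE, the second and third Kolyvagin primes of each row
# (2/3: `655a1`, `664a1`, `681c1`, `707a1`, `709a1`, `718b1`), kernel-certified (crux `KolyvaginDepthSupply`, stmt-BirchSwinnertonDyer-21765)

Helper file (`--supports stmt-BirchSwinnertonDyer-21765 --as helper`); it closes nothing and BSD is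
not proved by it. The route header asks the depth table for "the three smallest Kolyvagin primes ℓ
(inert, `p ∣ ℓ+1`, `p ∣ a_ℓ`)" per curve; the row files `KolyvaginDepthDoorDepthTableRows*` fix `(p, d_K)` and certify
the least one `ℓ₁` inside the full row certificate. This file certifies, for the same `(p, d_K)`, the
next two: `Zhang2014.IsKolyvaginPrime N_E E K p ℓ ∧ (1 : ℕ∞) ≤ levelIndex E p ℓ` for every quadratic
`K` with `d_K` as listed (kernel point count `#Ẽ(𝔽_ℓ)`, inertness by the Kronecker symbol, kit lemma
`isKolyvaginPrime_of_intModel_certificate`). Feeding any of them (with its `card_ℓ`) to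
`depthRow_of_intModel_certificate` gives the corresponding row verbatim.

| curve | `p` | `d_K` (`h_K`) | `ℓ₁` | `ℓ₂` (`a`) | `ℓ₃` (`a`) |
|---|---|---|---|---|---|
| `655a1` | `7` | `-51` (`2`) | `83` | `811` (`7`) | `1693` (`14`) |
| `664a1` | `5` | `-39` (`4`) | `29` | `179` (`0`) | `229` (`-10`) |
| `681c1` | `5` | `-83` (`3`) | `19` | `139` (`-20`) | `719` (`0`) |
| `707a1` | `5` | `-19` (`1`) | `179` | `409` (`10`) | `439` (`-20`) |
| `709a1` | `5` | `-7` (`1`) | `409` | `419` (`30`) | `509` (`-10`) |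
| `718b1` | `5` | `-7` (`1`) | `59` | `139` (`0`) | `269` (`20`) |

References: [WZhang2014] Notations (xii); [GrossLMS1991] §3 (3.1)–(3.3); [CremonaAlgorithms1997] Table 1.
-/


set_option linter.dupNamespace false

noncomputable section

open scoped Classical NumberField

namespace Summit.BirchSwinnertonDyer.BirchSwinnertonDyer.Theorems.KolyvaginDepthDoor

open Literature.NumberTheory.EllipticCurves Literature.NumberTheory.EllipticCurves.ModularForms
  WeierstrassCurve
open Summit.BirchSwinnertonDyer.BirchSwinnertonDyer.Rank2Observatory
open Summit.BirchSwinnertonDyer.BirchSwinnertonDyer.Rank1Residual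
open Summit.BirchSwinnertonDyer.Rank1Residual.Additive


/-! ## `655a1`: the next two Kolyvagin primes for `(p, d_K) = (7, -51)`: `ℓ = 811, 1693` -/

namespace C655a1

/-- `#Ẽ(𝔽_811) = 805`, `a_811 = 7` (Kolyvagin prime: `7 ∣ 811 + 1`, `7 ∣ a_811`) for `655a1`, kernel-decided (`ℕ`-arithmetic Euler
count `PointCountNat.natCard_point_map_eq`). [cite: CremonaAlgorithms1997, Table 1 (655a1)] -/
theorem card_811 :
    Nat.card (((⟨0, 0, 1, -13, 18⟩ : WeierstrassCurve ℤ).map (Int.castRingHom (ZMod 811))).toAffine.Point) = 805 := by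
  rw [PointCountNat.natCard_point_map_eq (hℓ := ⟨by norm_num⟩) (by norm_num) 0 0 1 (-13) 18
    (by decide +kernel)]
  decide +kernel

/-- `ℓ = 811` is a Kolyvagin prime for `(655a1, p = 7, d_K = -51)` with `M(811) ≥ 1`: `811` inert
(`(-51/811) = −1`), `7 ∣ 812`, `7 ∣ a_811 = 7`; JLS cost `[K[811] : K] = 1624`. [cite: WZhang2014, Notations (xii)] -/
theorem isKolyvaginPrime_811_neg51 (K : Type) [Field K] [NumberField K]
    (h2 : Module.finrank ℚ K = 2) (hD : NumberField.discr K = -51) :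
    haveI := isGloballyMinimal_c655a1;
    Zhang2014.IsKolyvaginPrime (((⟨0, 0, 1, -13, 18⟩ : WeierstrassCurve ℤ).map (Int.castRingHom ℚ)).conductorNorm ℤ) ((⟨0, 0, 1, -13, 18⟩ : WeierstrassCurve ℤ).map (Int.castRingHom ℚ)) K 7 811 ∧
      (1 : ℕ∞) ≤ Zhang2014.levelIndex ((⟨0, 0, 1, -13, 18⟩ : WeierstrassCurve ℤ).map (Int.castRingHom ℚ)) 7 811 := by
  haveI := Fact.mk (by norm_num : Nat.Prime 7)
  haveI := isElliptic_c655a1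
  haveI := isGloballyMinimal_c655a1
  exact isKolyvaginPrime_of_intModel_certificate intModel 7 K h2 hD 811 (by norm_num) (by norm_num)
    (by decide +kernel) (by norm_num) (by norm_num) (by norm_num) (by norm_num) (n := 805) card_811
    (by norm_num)

/-- `#Ẽ(𝔽_1693) = 1680`, `a_1693 = 14` (Kolyvagin prime: `7 ∣ 1693 + 1`, `7 ∣ a_1693`) for `655a1`, kernel-decided (`ℕ`-arithmetic Euler
count `PointCountNat.natCard_point_map_eq`). [cite: CremonaAlgorithms1997, Table 1 (655a1)] -/
theorem card_1693 :
    Nat.card (((⟨0, 0, 1, -13, 18⟩ : WeierstrassCurve ℤ).map (Int.castRingHom (ZMod 1693))).toAffine.Point) = 1680 := by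
  rw [PointCountNat.natCard_point_map_eq (hℓ := ⟨by norm_num⟩) (by norm_num) 0 0 1 (-13) 18
    (by decide +kernel)]
  decide +kernel

/-- `ℓ = 1693` is a Kolyvagin prime for `(655a1, p = 7, d_K = -51)` with `M(1693) ≥ 1`: `1693` inert
(`(-51/1693) = −1`), `7 ∣ 1694`, `7 ∣ a_1693 = 14`; JLS cost `[K[1693] : K] = 3388`. [cite: WZhang2014, Notations (xii)] -/
theorem isKolyvaginPrime_1693_neg51 (K : Type) [Field K] [NumberField K]
    (h2 : Module.finrank ℚ K = 2) (hD : NumberField.discr K = -51) :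
    haveI := isGloballyMinimal_c655a1;
    Zhang2014.IsKolyvaginPrime (((⟨0, 0, 1, -13, 18⟩ : WeierstrassCurve ℤ).map (Int.castRingHom ℚ)).conductorNorm ℤ) ((⟨0, 0, 1, -13, 18⟩ : WeierstrassCurve ℤ).map (Int.castRingHom ℚ)) K 7 1693 ∧
      (1 : ℕ∞) ≤ Zhang2014.levelIndex ((⟨0, 0, 1, -13, 18⟩ : WeierstrassCurve ℤ).map (Int.castRingHom ℚ)) 7 1693 := by
  haveI := Fact.mk (by norm_num : Nat.Prime 7)
  haveI := isElliptic_c655a1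
  haveI := isGloballyMinimal_c655a1
  exact isKolyvaginPrime_of_intModel_certificate intModel 7 K h2 hD 1693 (by norm_num) (by norm_num)
    (by decide +kernel) (by norm_num) (by norm_num) (by norm_num) (by norm_num) (n := 1680) card_1693
    (by norm_num)

end C655a1

/-! ## `664a1`: the next two Kolyvagin primes for `(p, d_K) = (5, -39)`: `ℓ = 179, 229` -/

namespace C664a1

/-- `#Ẽ(𝔽_179) = 180`, `a_179 = 0` (Kolyvagin prime: `5 ∣ 179 + 1`, `5 ∣ a_179`) for `664a1`, kernel-decided (`ℕ`-arithmetic Euler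
count `PointCountNat.natCard_point_map_eq`). [cite: CremonaAlgorithms1997, Table 1 (664a1)] -/
theorem card_179 :
    Nat.card (((⟨0, 0, 0, -7, 10⟩ : WeierstrassCurve ℤ).map (Int.castRingHom (ZMod 179))).toAffine.Point) = 180 := by
  rw [PointCountNat.natCard_point_map_eq (hℓ := ⟨by norm_num⟩) (by norm_num) 0 0 0 (-7) 10
    (by decide +kernel)]
  decide +kernel

/-- `ℓ = 179` is a Kolyvagin prime for `(664a1, p = 5, d_K = -39)` with `M(179) ≥ 1`: `179` inert
(`(-39/179) = −1`), `5 ∣ 180`, `5 ∣ a_179 = 0`; JLS cost `[K[179] : K] = 720`. [cite: WZhang2014, Notations (xii)] -/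
theorem isKolyvaginPrime_179_neg39 (K : Type) [Field K] [NumberField K]
    (h2 : Module.finrank ℚ K = 2) (hD : NumberField.discr K = -39) :
    haveI := isGloballyMinimal_c664a1;
    Zhang2014.IsKolyvaginPrime (((⟨0, 0, 0, -7, 10⟩ : WeierstrassCurve ℤ).map (Int.castRingHom ℚ)).conductorNorm ℤ) ((⟨0, 0, 0, -7, 10⟩ : WeierstrassCurve ℤ).map (Int.castRingHom ℚ)) K 5 179 ∧
      (1 : ℕ∞) ≤ Zhang2014.levelIndex ((⟨0, 0, 0, -7, 10⟩ : WeierstrassCurve ℤ).map (Int.castRingHom ℚ)) 5 179 := by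
  haveI := Fact.mk (by norm_num : Nat.Prime 5)
  haveI := isElliptic_c664a1
  haveI := isGloballyMinimal_c664a1
  exact isKolyvaginPrime_of_intModel_certificate intModel 5 K h2 hD 179 (by norm_num) (by norm_num)
    (by decide +kernel) (by norm_num) (by norm_num) (by norm_num) (by norm_num) (n := 180) card_179
    (by norm_num)

/-- `#Ẽ(𝔽_229) = 240`, `a_229 = -10` (Kolyvagin prime: `5 ∣ 229 + 1`, `5 ∣ a_229`) for `664a1`, kernel-decided (`ℕ`-arithmetic Euler
count `PointCountNat.natCard_point_map_eq`). [cite: CremonaAlgorithms1997, Table 1 (664a1)] -/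
theorem card_229 :
    Nat.card (((⟨0, 0, 0, -7, 10⟩ : WeierstrassCurve ℤ).map (Int.castRingHom (ZMod 229))).toAffine.Point) = 240 := by
  rw [PointCountNat.natCard_point_map_eq (hℓ := ⟨by norm_num⟩) (by norm_num) 0 0 0 (-7) 10
    (by decide +kernel)]
  decide +kernel

/-- `ℓ = 229` is a Kolyvagin prime for `(664a1, p = 5, d_K = -39)` with `M(229) ≥ 1`: `229` inert
(`(-39/229) = −1`), `5 ∣ 230`, `5 ∣ a_229 = -10`; JLS cost `[K[229] : K] = 920`. [cite: WZhang2014, Notations (xii)] -/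
theorem isKolyvaginPrime_229_neg39 (K : Type) [Field K] [NumberField K]
    (h2 : Module.finrank ℚ K = 2) (hD : NumberField.discr K = -39) :
    haveI := isGloballyMinimal_c664a1;
    Zhang2014.IsKolyvaginPrime (((⟨0, 0, 0, -7, 10⟩ : WeierstrassCurve ℤ).map (Int.castRingHom ℚ)).conductorNorm ℤ) ((⟨0, 0, 0, -7, 10⟩ : WeierstrassCurve ℤ).map (Int.castRingHom ℚ)) K 5 229 ∧
      (1 : ℕ∞) ≤ Zhang2014.levelIndex ((⟨0, 0, 0, -7, 10⟩ : WeierstrassCurve ℤ).map (Int.castRingHom ℚ)) 5 229 := by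
  haveI := Fact.mk (by norm_num : Nat.Prime 5)
  haveI := isElliptic_c664a1
  haveI := isGloballyMinimal_c664a1
  exact isKolyvaginPrime_of_intModel_certificate intModel 5 K h2 hD 229 (by norm_num) (by norm_num)
    (by decide +kernel) (by norm_num) (by norm_num) (by norm_num) (by norm_num) (n := 240) card_229
    (by norm_num)

end C664a1

/-! ## `681c1`: the next two Kolyvagin primes for `(p, d_K) = (5, -83)`: `ℓ = 139, 719` -/

namespace C681c1

/-- `#Ẽ(𝔽_139) = 160`, `a_139 = -20` (Kolyvagin prime: `5 ∣ 139 + 1`, `5 ∣ a_139`) for `681c1`, kernel-decided (`ℕ`-arithmetic Euler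
count `PointCountNat.natCard_point_map_eq`). [cite: CremonaAlgorithms1997, Table 1 (681c1)] -/
theorem card_139 :
    Nat.card (((⟨0, -1, 1, 0, 2⟩ : WeierstrassCurve ℤ).map (Int.castRingHom (ZMod 139))).toAffine.Point) = 160 := by
  rw [PointCountNat.natCard_point_map_eq (hℓ := ⟨by norm_num⟩) (by norm_num) 0 (-1) 1 0 2
    (by decide +kernel)]
  decide +kernel

/-- `ℓ = 139` is a Kolyvagin prime for `(681c1, p = 5, d_K = -83)` with `M(139) ≥ 1`: `139` inert
(`(-83/139) = −1`), `5 ∣ 140`, `5 ∣ a_139 = -20`; JLS cost `[K[139] : K] = 420`. [cite: WZhang2014, Notations (xii)] -/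
theorem isKolyvaginPrime_139_neg83 (K : Type) [Field K] [NumberField K]
    (h2 : Module.finrank ℚ K = 2) (hD : NumberField.discr K = -83) :
    haveI := isGloballyMinimal_c681c1;
    Zhang2014.IsKolyvaginPrime (((⟨0, -1, 1, 0, 2⟩ : WeierstrassCurve ℤ).map (Int.castRingHom ℚ)).conductorNorm ℤ) ((⟨0, -1, 1, 0, 2⟩ : WeierstrassCurve ℤ).map (Int.castRingHom ℚ)) K 5 139 ∧
      (1 : ℕ∞) ≤ Zhang2014.levelIndex ((⟨0, -1, 1, 0, 2⟩ : WeierstrassCurve ℤ).map (Int.castRingHom ℚ)) 5 139 := by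
  haveI := Fact.mk (by norm_num : Nat.Prime 5)
  haveI := isElliptic_c681c1
  haveI := isGloballyMinimal_c681c1
  exact isKolyvaginPrime_of_intModel_certificate intModel 5 K h2 hD 139 (by norm_num) (by norm_num)
    (by decide +kernel) (by norm_num) (by norm_num) (by norm_num) (by norm_num) (n := 160) card_139
    (by norm_num)

/-- `#Ẽ(𝔽_719) = 720`, `a_719 = 0` (Kolyvagin prime: `5 ∣ 719 + 1`, `5 ∣ a_719`) for `681c1`, kernel-decided (`ℕ`-arithmetic Euler
count `PointCountNat.natCard_point_map_eq`). [cite: CremonaAlgorithms1997, Table 1 (681c1)] -/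
theorem card_719 :
    Nat.card (((⟨0, -1, 1, 0, 2⟩ : WeierstrassCurve ℤ).map (Int.castRingHom (ZMod 719))).toAffine.Point) = 720 := by
  rw [PointCountNat.natCard_point_map_eq (hℓ := ⟨by norm_num⟩) (by norm_num) 0 (-1) 1 0 2
    (by decide +kernel)]
  decide +kernel

/-- `ℓ = 719` is a Kolyvagin prime for `(681c1, p = 5, d_K = -83)` with `M(719) ≥ 1`: `719` inert
(`(-83/719) = −1`), `5 ∣ 720`, `5 ∣ a_719 = 0`; JLS cost `[K[719] : K] = 2160`. [cite: WZhang2014, Notations (xii)] -/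
theorem isKolyvaginPrime_719_neg83 (K : Type) [Field K] [NumberField K]
    (h2 : Module.finrank ℚ K = 2) (hD : NumberField.discr K = -83) :
    haveI := isGloballyMinimal_c681c1;
    Zhang2014.IsKolyvaginPrime (((⟨0, -1, 1, 0, 2⟩ : WeierstrassCurve ℤ).map (Int.castRingHom ℚ)).conductorNorm ℤ) ((⟨0, -1, 1, 0, 2⟩ : WeierstrassCurve ℤ).map (Int.castRingHom ℚ)) K 5 719 ∧
      (1 : ℕ∞) ≤ Zhang2014.levelIndex ((⟨0, -1, 1, 0, 2⟩ : WeierstrassCurve ℤ).map (Int.castRingHom ℚ)) 5 719 := by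
  haveI := Fact.mk (by norm_num : Nat.Prime 5)
  haveI := isElliptic_c681c1
  haveI := isGloballyMinimal_c681c1
  exact isKolyvaginPrime_of_intModel_certificate intModel 5 K h2 hD 719 (by norm_num) (by norm_num)
    (by decide +kernel) (by norm_num) (by norm_num) (by norm_num) (by norm_num) (n := 720) card_719
    (by norm_num)

end C681c1

/-! ## `707a1`: the next two Kolyvagin primes for `(p, d_K) = (5, -19)`: `ℓ = 409, 439` -/

namespace C707a1

/-- `#Ẽ(𝔽_409) = 400`, `a_409 = 10` (Kolyvagin prime: `5 ∣ 409 + 1`, `5 ∣ a_409`) for `707a1`, kernel-decided (`ℕ`-arithmetic Euler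
count `PointCountNat.natCard_point_map_eq`). [cite: CremonaAlgorithms1997, Table 1 (707a1)] -/
theorem card_409 :
    Nat.card (((⟨0, 1, 1, -12, 12⟩ : WeierstrassCurve ℤ).map (Int.castRingHom (ZMod 409))).toAffine.Point) = 400 := by
  rw [PointCountNat.natCard_point_map_eq (hℓ := ⟨by norm_num⟩) (by norm_num) 0 1 1 (-12) 12
    (by decide +kernel)]
  decide +kernel

/-- `ℓ = 409` is a Kolyvagin prime for `(707a1, p = 5, d_K = -19)` with `M(409) ≥ 1`: `409` inert
(`(-19/409) = −1`), `5 ∣ 410`, `5 ∣ a_409 = 10`; JLS cost `[K[409] : K] = 410`. [cite: WZhang2014, Notations (xii)] -/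
theorem isKolyvaginPrime_409_neg19 (K : Type) [Field K] [NumberField K]
    (h2 : Module.finrank ℚ K = 2) (hD : NumberField.discr K = -19) :
    haveI := isGloballyMinimal_c707a1;
    Zhang2014.IsKolyvaginPrime (((⟨0, 1, 1, -12, 12⟩ : WeierstrassCurve ℤ).map (Int.castRingHom ℚ)).conductorNorm ℤ) ((⟨0, 1, 1, -12, 12⟩ : WeierstrassCurve ℤ).map (Int.castRingHom ℚ)) K 5 409 ∧
      (1 : ℕ∞) ≤ Zhang2014.levelIndex ((⟨0, 1, 1, -12, 12⟩ : WeierstrassCurve ℤ).map (Int.castRingHom ℚ)) 5 409 := by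
  haveI := Fact.mk (by norm_num : Nat.Prime 5)
  haveI := isElliptic_c707a1
  haveI := isGloballyMinimal_c707a1
  exact isKolyvaginPrime_of_intModel_certificate intModel 5 K h2 hD 409 (by norm_num) (by norm_num)
    (by decide +kernel) (by norm_num) (by norm_num) (by norm_num) (by norm_num) (n := 400) card_409
    (by norm_num)

/-- `#Ẽ(𝔽_439) = 460`, `a_439 = -20` (Kolyvagin prime: `5 ∣ 439 + 1`, `5 ∣ a_439`) for `707a1`, kernel-decided (`ℕ`-arithmetic Euler
count `PointCountNat.natCard_point_map_eq`). [cite: CremonaAlgorithms1997, Table 1 (707a1)] -/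
theorem card_439 :
    Nat.card (((⟨0, 1, 1, -12, 12⟩ : WeierstrassCurve ℤ).map (Int.castRingHom (ZMod 439))).toAffine.Point) = 460 := by
  rw [PointCountNat.natCard_point_map_eq (hℓ := ⟨by norm_num⟩) (by norm_num) 0 1 1 (-12) 12
    (by decide +kernel)]
  decide +kernel

/-- `ℓ = 439` is a Kolyvagin prime for `(707a1, p = 5, d_K = -19)` with `M(439) ≥ 1`: `439` inert
(`(-19/439) = −1`), `5 ∣ 440`, `5 ∣ a_439 = -20`; JLS cost `[K[439] : K] = 440`. [cite: WZhang2014, Notations (xii)] -/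
theorem isKolyvaginPrime_439_neg19 (K : Type) [Field K] [NumberField K]
    (h2 : Module.finrank ℚ K = 2) (hD : NumberField.discr K = -19) :
    haveI := isGloballyMinimal_c707a1;
    Zhang2014.IsKolyvaginPrime (((⟨0, 1, 1, -12, 12⟩ : WeierstrassCurve ℤ).map (Int.castRingHom ℚ)).conductorNorm ℤ) ((⟨0, 1, 1, -12, 12⟩ : WeierstrassCurve ℤ).map (Int.castRingHom ℚ)) K 5 439 ∧
      (1 : ℕ∞) ≤ Zhang2014.levelIndex ((⟨0, 1, 1, -12, 12⟩ : WeierstrassCurve ℤ).map (Int.castRingHom ℚ)) 5 439 := by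
  haveI := Fact.mk (by norm_num : Nat.Prime 5)
  haveI := isElliptic_c707a1
  haveI := isGloballyMinimal_c707a1
  exact isKolyvaginPrime_of_intModel_certificate intModel 5 K h2 hD 439 (by norm_num) (by norm_num)
    (by decide +kernel) (by norm_num) (by norm_num) (by norm_num) (by norm_num) (n := 460) card_439
    (by norm_num)

end C707a1

/-! ## `709a1`: the next two Kolyvagin primes for `(p, d_K) = (5, -7)`: `ℓ = 419, 509` -/

namespace C709a1

/-- `#Ẽ(𝔽_419) = 390`, `a_419 = 30` (Kolyvagin prime: `5 ∣ 419 + 1`, `5 ∣ a_419`) for `709a1`, kernel-decided (`ℕ`-arithmetic Euler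
count `PointCountNat.natCard_point_map_eq`). [cite: CremonaAlgorithms1997, Table 1 (709a1)] -/
theorem card_419 :
    Nat.card (((⟨0, -1, 1, -2, 0⟩ : WeierstrassCurve ℤ).map (Int.castRingHom (ZMod 419))).toAffine.Point) = 390 := by
  rw [PointCountNat.natCard_point_map_eq (hℓ := ⟨by norm_num⟩) (by norm_num) 0 (-1) 1 (-2) 0
    (by decide +kernel)]
  decide +kernel

/-- `ℓ = 419` is a Kolyvagin prime for `(709a1, p = 5, d_K = -7)` with `M(419) ≥ 1`: `419` inert
(`(-7/419) = −1`), `5 ∣ 420`, `5 ∣ a_419 = 30`; JLS cost `[K[419] : K] = 420`. [cite: WZhang2014, Notations (xii)] -/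
theorem isKolyvaginPrime_419_neg7 (K : Type) [Field K] [NumberField K]
    (h2 : Module.finrank ℚ K = 2) (hD : NumberField.discr K = -7) :
    haveI := isGloballyMinimal_c709a1;
    Zhang2014.IsKolyvaginPrime (((⟨0, -1, 1, -2, 0⟩ : WeierstrassCurve ℤ).map (Int.castRingHom ℚ)).conductorNorm ℤ) ((⟨0, -1, 1, -2, 0⟩ : WeierstrassCurve ℤ).map (Int.castRingHom ℚ)) K 5 419 ∧
      (1 : ℕ∞) ≤ Zhang2014.levelIndex ((⟨0, -1, 1, -2, 0⟩ : WeierstrassCurve ℤ).map (Int.castRingHom ℚ)) 5 419 := by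
  haveI := Fact.mk (by norm_num : Nat.Prime 5)
  haveI := isElliptic_c709a1
  haveI := isGloballyMinimal_c709a1
  exact isKolyvaginPrime_of_intModel_certificate intModel 5 K h2 hD 419 (by norm_num) (by norm_num)
    (by decide +kernel) (by norm_num) (by norm_num) (by norm_num) (by norm_num) (n := 390) card_419
    (by norm_num)

/-- `#Ẽ(𝔽_509) = 520`, `a_509 = -10` (Kolyvagin prime: `5 ∣ 509 + 1`, `5 ∣ a_509`) for `709a1`, kernel-decided (`ℕ`-arithmetic Euler
count `PointCountNat.natCard_point_map_eq`). [cite: CremonaAlgorithms1997, Table 1 (709a1)] -/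
theorem card_509 :
    Nat.card (((⟨0, -1, 1, -2, 0⟩ : WeierstrassCurve ℤ).map (Int.castRingHom (ZMod 509))).toAffine.Point) = 520 := by
  rw [PointCountNat.natCard_point_map_eq (hℓ := ⟨by norm_num⟩) (by norm_num) 0 (-1) 1 (-2) 0
    (by decide +kernel)]
  decide +kernel

/-- `ℓ = 509` is a Kolyvagin prime for `(709a1, p = 5, d_K = -7)` with `M(509) ≥ 1`: `509` inert
(`(-7/509) = −1`), `5 ∣ 510`, `5 ∣ a_509 = -10`; JLS cost `[K[509] : K] = 510`. [cite: WZhang2014, Notations (xii)] -/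
theorem isKolyvaginPrime_509_neg7 (K : Type) [Field K] [NumberField K]
    (h2 : Module.finrank ℚ K = 2) (hD : NumberField.discr K = -7) :
    haveI := isGloballyMinimal_c709a1;
    Zhang2014.IsKolyvaginPrime (((⟨0, -1, 1, -2, 0⟩ : WeierstrassCurve ℤ).map (Int.castRingHom ℚ)).conductorNorm ℤ) ((⟨0, -1, 1, -2, 0⟩ : WeierstrassCurve ℤ).map (Int.castRingHom ℚ)) K 5 509 ∧
      (1 : ℕ∞) ≤ Zhang2014.levelIndex ((⟨0, -1, 1, -2, 0⟩ : WeierstrassCurve ℤ).map (Int.castRingHom ℚ)) 5 509 := by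
  haveI := Fact.mk (by norm_num : Nat.Prime 5)
  haveI := isElliptic_c709a1
  haveI := isGloballyMinimal_c709a1
  exact isKolyvaginPrime_of_intModel_certificate intModel 5 K h2 hD 509 (by norm_num) (by norm_num)
    (by decide +kernel) (by norm_num) (by norm_num) (by norm_num) (by norm_num) (n := 520) card_509
    (by norm_num)

end C709a1

/-! ## `718b1`: the next two Kolyvagin primes for `(p, d_K) = (5, -7)`: `ℓ = 139, 269` -/

namespace C718b1

/-- `#Ẽ(𝔽_139) = 140`, `a_139 = 0` (Kolyvagin prime: `5 ∣ 139 + 1`, `5 ∣ a_139`) for `718b1`, kernel-decided (`ℕ`-arithmetic Euler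
count `PointCountNat.natCard_point_map_eq`). [cite: CremonaAlgorithms1997, Table 1 (718b1)] -/
theorem card_139 :
    Nat.card (((⟨1, 0, 1, -5, 0⟩ : WeierstrassCurve ℤ).map (Int.castRingHom (ZMod 139))).toAffine.Point) = 140 := by
  rw [PointCountNat.natCard_point_map_eq (hℓ := ⟨by norm_num⟩) (by norm_num) 1 0 1 (-5) 0
    (by decide +kernel)]
  decide +kernel

/-- `ℓ = 139` is a Kolyvagin prime for `(718b1, p = 5, d_K = -7)` with `M(139) ≥ 1`: `139` inert
(`(-7/139) = −1`), `5 ∣ 140`, `5 ∣ a_139 = 0`; JLS cost `[K[139] : K] = 140`. [cite: WZhang2014, Notations (xii)] -/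
theorem isKolyvaginPrime_139_neg7 (K : Type) [Field K] [NumberField K]
    (h2 : Module.finrank ℚ K = 2) (hD : NumberField.discr K = -7) :
    haveI := isGloballyMinimal_c718b1;
    Zhang2014.IsKolyvaginPrime (((⟨1, 0, 1, -5, 0⟩ : WeierstrassCurve ℤ).map (Int.castRingHom ℚ)).conductorNorm ℤ) ((⟨1, 0, 1, -5, 0⟩ : WeierstrassCurve ℤ).map (Int.castRingHom ℚ)) K 5 139 ∧
      (1 : ℕ∞) ≤ Zhang2014.levelIndex ((⟨1, 0, 1, -5, 0⟩ : WeierstrassCurve ℤ).map (Int.castRingHom ℚ)) 5 139 := by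
  haveI := Fact.mk (by norm_num : Nat.Prime 5)
  haveI := isElliptic_c718b1
  haveI := isGloballyMinimal_c718b1
  exact isKolyvaginPrime_of_intModel_certificate intModel 5 K h2 hD 139 (by norm_num) (by norm_num)
    (by decide +kernel) (by norm_num) (by norm_num) (by norm_num) (by norm_num) (n := 140) card_139
    (by norm_num)

/-- `#Ẽ(𝔽_269) = 250`, `a_269 = 20` (Kolyvagin prime: `5 ∣ 269 + 1`, `5 ∣ a_269`) for `718b1`, kernel-decided (`ℕ`-arithmetic Euler
count `PointCountNat.natCard_point_map_eq`). [cite: CremonaAlgorithms1997, Table 1 (718b1)] -/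
theorem card_269 :
    Nat.card (((⟨1, 0, 1, -5, 0⟩ : WeierstrassCurve ℤ).map (Int.castRingHom (ZMod 269))).toAffine.Point) = 250 := by
  rw [PointCountNat.natCard_point_map_eq (hℓ := ⟨by norm_num⟩) (by norm_num) 1 0 1 (-5) 0
    (by decide +kernel)]
  decide +kernel

/-- `ℓ = 269` is a Kolyvagin prime for `(718b1, p = 5, d_K = -7)` with `M(269) ≥ 1`: `269` inert
(`(-7/269) = −1`), `5 ∣ 270`, `5 ∣ a_269 = 20`; JLS cost `[K[269] : K] = 270`. [cite: WZhang2014, Notations (xii)] -/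
theorem isKolyvaginPrime_269_neg7 (K : Type) [Field K] [NumberField K]
    (h2 : Module.finrank ℚ K = 2) (hD : NumberField.discr K = -7) :
    haveI := isGloballyMinimal_c718b1;
    Zhang2014.IsKolyvaginPrime (((⟨1, 0, 1, -5, 0⟩ : WeierstrassCurve ℤ).map (Int.castRingHom ℚ)).conductorNorm ℤ) ((⟨1, 0, 1, -5, 0⟩ : WeierstrassCurve ℤ).map (Int.castRingHom ℚ)) K 5 269 ∧
      (1 : ℕ∞) ≤ Zhang2014.levelIndex ((⟨1, 0, 1, -5, 0⟩ : WeierstrassCurve ℤ).map (Int.castRingHom ℚ)) 5 269 := by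
  haveI := Fact.mk (by norm_num : Nat.Prime 5)
  haveI := isElliptic_c718b1
  haveI := isGloballyMinimal_c718b1
  exact isKolyvaginPrime_of_intModel_certificate intModel 5 K h2 hD 269 (by norm_num) (by norm_num)
    (by decide +kernel) (by norm_num) (by norm_num) (by norm_num) (by norm_num) (n := 250) card_269
    (by norm_num)

end C718b1

end Summit.BirchSwinnertonDyer.BirchSwinnertonDyer.Theorems.KolyvaginDepthDoor

end
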